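import Mathlib.Analysis.SpecialFunctions.Pow.NthRootLemmas
import Literature.Computability.Complexity.NSubexp
import Literature.Computability.Complexity.StackMachines
import HarnessLib

/-!
# Arithmetic of the `∃`-closure of `NSUBEXP`: integer roots, subexponential domination, and
# the witness-splitting functions

First of five files (`PolyExistsNTIMEArith`, `…Programs`, `…Clock`, `…Shuffle`, `PolyExistsNTIME`)
proving the named fact
`Literature.Computability.Complexity.polyExists_NSUBEXP_subset_NSUBEXP`
(`AaronsonVanMelkebeek2011.lean`): `polyExists NSUBEXP ⊆ NSUBEXP` for the tree's verifier-form
`NTIME` (`Nondeterministic.lean`) and `NSUBEXP = ⋂_{r>0} NTIME(2^{⌊n^{1/r}⌋})` (`NSubexp.lean`).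
This file holds the machine-free part:

* integer roots: `nthRoot_mono_right`, `nthRoot_le_self`, `nthRoot_mul_pow_le`
  (`⌊(n^d)^{1/(dr)}⌋ ≤ ⌊n^{1/r}⌋`) and **`exists_nthRoot_poly_le`**: for `d, r ≥ 1` there is `K`
  with `⌊(A·n^d + A)^{1/(2dr)}⌋ ≤ ⌊n^{1/r}⌋ + K` for all `n` — the exponent bookkeeping behind
  "a polynomial blow-up of the input keeps a subexponential bound subexponential";
* **`exists_poly_le_two_pow_nthRoot`**: every polynomial is `≤ C · 2^{⌊n^{1/r}⌋} + C`;
* the pure function computed by the witness-reading phase of the shuffle program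
  (`PolyExistsNTIMEShuffle.lean`): `readY k v` (read at most `k` doubled bits of `v` up to the first separator pair; returns the
  bits and the remainder), with `readY_dbl_sep` (on `dbl y ++ 0 1 z` it returns `(y, z)` when
  `|y| ≤ k`) and the length bounds the verifier needs.

## References

* S. Aaronson, D. van Melkebeek, *On circuit lower bounds from derandomization*, Theory of
  Computing 7 (2011), proof of Lemma 3.1 (the `∃` in front of an `NSUBEXP` predicate).
* S. Arora, B. Barak, *Computational Complexity: A Modern Approach*, CUP 2009, Def. 2.1, Thm. 2.6
  (guess-and-verify), §1.3.
-/

namespace Literature.Computability.Complexity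

namespace PolyExistsNTIME

open Nat

/-! ### Integer roots -/

/-- `Nat.nthRoot k` is monotone in the radicand (`k ≠ 0`). [folklore] -/
theorem nthRoot_mono_right {k : ℕ} (hk : k ≠ 0) {a b : ℕ} (h : a ≤ b) :
    Nat.nthRoot k a ≤ Nat.nthRoot k b :=
  (Nat.le_nthRoot_iff hk).2 ((Nat.pow_nthRoot_le (Or.inl hk)).trans h)

/-- `⌊a^{1/k}⌋ ≤ a` (`k ≠ 0`). [folklore] -/
theorem nthRoot_le_self {k : ℕ} (hk : k ≠ 0) (a : ℕ) : Nat.nthRoot k a ≤ a := by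
  have h : Nat.nthRoot k a < a + 1 :=
    (Nat.nthRoot_lt_iff hk).2 ((Nat.lt_succ_self a).trans_le (Nat.le_self_pow hk _))
  omega

/-- `⌊(n^d)^{1/(d r)}⌋ ≤ ⌊n^{1/r}⌋` (`d, r ≠ 0`): from `n < (⌊n^{1/r}⌋ + 1)^r` raised to the
`d`-th power. [folklore] -/
theorem nthRoot_mul_pow_le {d r : ℕ} (hd : d ≠ 0) (hr : r ≠ 0) (n : ℕ) :
    Nat.nthRoot (d * r) (n ^ d) ≤ Nat.nthRoot r n := by
  have h := Nat.lt_pow_nthRoot_add_one hr n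
  have h' : n ^ d < (Nat.nthRoot r n + 1) ^ (d * r) := by
    rw [mul_comm, pow_mul]
    exact Nat.pow_lt_pow_left h hd
  have := (Nat.nthRoot_lt_iff (Nat.mul_ne_zero hd hr)).2 h'
  omega

/-- **Polynomial blow-up under integer roots**: for `d, r ≠ 0` and any `A` there is `K` with
`⌊(A·n^d + A)^{1/(2 d r)}⌋ ≤ ⌊n^{1/r}⌋ + K` for all `n` (for `n^d ≥ 2A` the radicand is at most
`n^{2d}`; the finitely many other `n` are absorbed by `K`). [folklore] -/
theorem exists_nthRoot_poly_le (A : ℕ) {d r : ℕ} (hd : d ≠ 0) (hr : r ≠ 0) :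
    ∃ K : ℕ, ∀ n : ℕ, Nat.nthRoot (2 * d * r) (A * n ^ d + A) ≤ Nat.nthRoot r n + K := by
  refine ⟨2 * A * A + A, fun n => ?_⟩
  have h2dr : 2 * d * r ≠ 0 := Nat.mul_ne_zero (Nat.mul_ne_zero two_ne_zero hd) hr
  rcases le_or_gt (2 * A) (n ^ d) with hA | hA
  · -- large `n`: `A n^d + A ≤ 2 A n^d ≤ n^d n^d = n^(2d)`
    have hle : A * n ^ d + A ≤ n ^ (2 * d) := by
      have h1 : A * n ^ d + A ≤ 2 * A * n ^ d := by
        have : A ≤ A * n ^ d := by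
          rcases Nat.eq_zero_or_pos A with rfl | hA0
          · simp
          · exact Nat.le_mul_of_pos_right _ (by nlinarith)
        nlinarith
      calc A * n ^ d + A ≤ 2 * A * n ^ d := h1
        _ ≤ n ^ d * n ^ d := Nat.mul_le_mul_right _ hA
        _ = n ^ (2 * d) := by rw [two_mul, pow_add]
    calc Nat.nthRoot (2 * d * r) (A * n ^ d + A)
        ≤ Nat.nthRoot (2 * d * r) (n ^ (2 * d)) := nthRoot_mono_right h2dr hle
      _ ≤ Nat.nthRoot r n := nthRoot_mul_pow_le (Nat.mul_ne_zero two_ne_zero hd) hr n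
      _ ≤ Nat.nthRoot r n + (2 * A * A + A) := Nat.le_add_right _ _
  · -- small `n`: the radicand is below `2 A² + A`
    have hle : A * n ^ d + A ≤ 2 * A * A + A := by nlinarith
    calc Nat.nthRoot (2 * d * r) (A * n ^ d + A) ≤ A * n ^ d + A := nthRoot_le_self h2dr _
      _ ≤ 2 * A * A + A := hle
      _ ≤ Nat.nthRoot r n + (2 * A * A + A) := Nat.le_add_left _ _

/-- The bound of `exists_nthRoot_poly_le` on the exponential scale:
`2^{⌊(A n^d + A)^{1/(2dr)}⌋} ≤ 2^K · 2^{⌊n^{1/r}⌋}`. [folklore] -/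
theorem exists_two_pow_nthRoot_poly_le (A : ℕ) {d r : ℕ} (hd : d ≠ 0) (hr : r ≠ 0) :
    ∃ D : ℕ, ∀ n : ℕ, 2 ^ Nat.nthRoot (2 * d * r) (A * n ^ d + A) ≤ D * 2 ^ Nat.nthRoot r n := by
  obtain ⟨K, hK⟩ := exists_nthRoot_poly_le A hd hr
  refine ⟨2 ^ K, fun n => ?_⟩
  calc 2 ^ Nat.nthRoot (2 * d * r) (A * n ^ d + A) ≤ 2 ^ (Nat.nthRoot r n + K) :=
        Nat.pow_le_pow_right Nat.two_pos (hK n)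
    _ = 2 ^ K * 2 ^ Nat.nthRoot r n := by rw [pow_add, mul_comm]

/-! ### Polynomials are subexponential -/

/-- `n^d ≤ C · 2^{⌊n^{1/r}⌋}` for a constant `C = C(d, r)` (`r ≠ 0`): `n < (s+1)^r` for
`s = ⌊n^{1/r}⌋`, and `(s+1)^{rd} ≤ C' 2^{s+1}`. [folklore] -/
theorem exists_pow_le_mul_two_pow_nthRoot (d : ℕ) {r : ℕ} (hr : r ≠ 0) :
    ∃ C : ℕ, ∀ n : ℕ, n ^ d ≤ C * 2 ^ Nat.nthRoot r n := by
  obtain ⟨C, hC⟩ := TimeConstructible.exists_pow_le_mul_two_pow (r * d)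
  refine ⟨2 * C, fun n => ?_⟩
  set s := Nat.nthRoot r n with hs
  have h1 : n ^ d ≤ (s + 1) ^ (r * d) := by
    rw [pow_mul]
    exact Nat.pow_le_pow_left (Nat.lt_pow_nthRoot_add_one hr n).le d
  calc n ^ d ≤ (s + 1) ^ (r * d) := h1
    _ ≤ C * 2 ^ (s + 1) := hC (s + 1)
    _ = 2 * C * 2 ^ s := by rw [pow_succ]; ring

/-- **Every polynomial is dominated by `C · 2^{⌊n^{1/r}⌋} + C`** (`r ≠ 0`). [folklore] -/
theorem exists_poly_le_two_pow_nthRoot (q : Polynomial ℕ) {r : ℕ} (hr : r ≠ 0) :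
    ∃ C : ℕ, ∀ n : ℕ, q.eval n ≤ C * 2 ^ Nat.nthRoot r n + C := by
  obtain ⟨c₁, d, h₁⟩ := exists_eval_le_mul_pow_add q
  obtain ⟨C, hC⟩ := exists_pow_le_mul_two_pow_nthRoot d hr
  refine ⟨c₁ * C + c₁, fun n => ?_⟩
  calc q.eval n ≤ c₁ * n ^ d + c₁ := h₁ n
    _ ≤ c₁ * (C * 2 ^ Nat.nthRoot r n) + c₁ := by gcongr; exact hC n
    _ ≤ (c₁ * C + c₁) * 2 ^ Nat.nthRoot r n + (c₁ * C + c₁) := by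
        nlinarith [Nat.one_le_two_pow (n := Nat.nthRoot r n)]

/-- The arithmetic shape `c · n^d + c` is dominated likewise. [folklore] -/
theorem exists_mul_pow_add_le_two_pow_nthRoot (c d : ℕ) {r : ℕ} (hr : r ≠ 0) :
    ∃ C : ℕ, ∀ n : ℕ, c * n ^ d + c ≤ C * 2 ^ Nat.nthRoot r n + C := by
  obtain ⟨C, hC⟩ := exists_pow_le_mul_two_pow_nthRoot d hr
  refine ⟨c * C + c, fun n => ?_⟩
  calc c * n ^ d + c ≤ c * (C * 2 ^ Nat.nthRoot r n) + c := by gcongr; exact hC n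
    _ ≤ (c * C + c) * 2 ^ Nat.nthRoot r n + (c * C + c) := by
        nlinarith [Nat.one_le_two_pow (n := Nat.nthRoot r n)]

/-! ### Reading a bounded number of doubled bits -/

/-- `readY k v`: read pairs of symbols of `v` while a budget of `k` pairs lasts: an equal pair
`bb` is the bit `b` (recorded, budget decremented), an unequal pair (the separator `01`, or junk
`10`) ends the reading and is consumed, a single leftover symbol is consumed and ends the
reading; when the budget is exhausted the next two symbols (the separator, on an honest
witness of maximal length) are dropped unread. Returns the bits read and the remainder.
This is the pure function computed by the witness-reading phase of the shuffle program
(`PolyExistsNTIMEShuffle.lean`). [folklore] -/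
def readY : ℕ → List Bool → List Bool × List Bool
  | 0, v => ([], v.drop 2)
  | _ + 1, [] => ([], [])
  | _ + 1, [_] => ([], [])
  | k + 1, b :: b' :: v => if b = b' then (b :: (readY k v).1, (readY k v).2) else ([], v)

/-- Budget `0`: drop the next pair. [folklore] -/
@[simp] theorem readY_zero (v : List Bool) : readY 0 v = ([], v.drop 2) := rfl

/-- Empty input. [folklore] -/
@[simp] theorem readY_succ_nil (k : ℕ) : readY (k + 1) [] = ([], []) := rfl

/-- A single leftover symbol. [folklore] -/
@[simp] theorem readY_succ_single (k : ℕ) (b : Bool) : readY (k + 1) [b] = ([], []) := rfl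

/-- An equal pair is a bit. [folklore] -/
@[simp] theorem readY_succ_cons_cons_self (k : ℕ) (b : Bool) (v : List Bool) :
    readY (k + 1) (b :: b :: v) = (b :: (readY k v).1, (readY k v).2) := by
  simp [readY]

/-- An unequal pair ends the reading. [folklore] -/
theorem readY_succ_cons_cons_ne (k : ℕ) {b b' : Bool} (h : b ≠ b') (v : List Bool) :
    readY (k + 1) (b :: b' :: v) = ([], v) := by
  simp [readY, h]

/-- At most `k` bits are read. [folklore] -/
theorem length_readY_fst_le : ∀ (k : ℕ) (v : List Bool), (readY k v).1.length ≤ k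
  | 0, v => by simp
  | _ + 1, [] => by simp
  | _ + 1, [_] => by simp
  | k + 1, b :: b' :: v => by
    by_cases h : b = b'
    · subst h
      simpa using length_readY_fst_le k v
    · simp [readY_succ_cons_cons_ne k h]

/-- The remainder is a part of the input: its length does not exceed the input's. [folklore] -/
theorem length_readY_snd_le : ∀ (k : ℕ) (v : List Bool), (readY k v).2.length ≤ v.length
  | 0, v => by simp
  | _ + 1, [] => by simp
  | _ + 1, [_] => by simp
  | k + 1, b :: b' :: v => by
    by_cases h : b = b'
    · subst h
      have := length_readY_snd_le k v
      simp only [readY_succ_cons_cons_self, List.length_cons]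
      omega
    · simp [readY_succ_cons_cons_ne k h]; omega

/-- Bits read plus remainder fit in the input: `2 |bits| + |rest| ≤ |v|`. [folklore] -/
theorem two_mul_length_readY_add_le : ∀ (k : ℕ) (v : List Bool),
    2 * (readY k v).1.length + (readY k v).2.length ≤ v.length
  | 0, v => by simp
  | _ + 1, [] => by simp
  | _ + 1, [_] => by simp
  | k + 1, b :: b' :: v => by
    by_cases h : b = b'
    · subst h
      have := two_mul_length_readY_add_le k v
      simp only [readY_succ_cons_cons_self, List.length_cons]
      omega
    · simp [readY_succ_cons_cons_ne k h]; omega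

/-- `boolPair x y = dbl x ++ 0 :: 1 :: y` for the tree's bit-doubling map `SProg.dbl`
(`StackMachines.lean`; the same identity is proved locally in unrelated files, e.g.
`Cryptography/ShorFactPost.lean`, which this toolkit does not import). [folklore] -/
theorem boolPair_eq_dbl (x y : List Bool) : boolPair x y = SProg.dbl x ++ false :: true :: y := by
  induction x with
  | nil => rfl
  | cons b x ih => simp [boolPair, SProg.dbl, List.flatMap_cons]

/-- **On an honest witness the reader returns it**: `readY k (dbl y ++ 0 1 z) = (y, z)` whenever
`|y| ≤ k`. [folklore] -/
theorem readY_dbl_sep {k : ℕ} {y : List Bool} (z : List Bool) (h : y.length ≤ k) :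
    readY k (SProg.dbl y ++ false :: true :: z) = (y, z) := by
  induction y generalizing k with
  | nil =>
    cases k with
    | zero => simp
    | succ k => simp [readY_succ_cons_cons_ne k (show false ≠ true by decide)]
  | cons b y ih =>
    cases k with
    | zero => simp at h
    | succ k =>
      have hk : y.length ≤ k := by simpa using h
      simp [ih hk]

end PolyExistsNTIME

end Literature.Computability.Complexity
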